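import Summits.Parity.BatemanHorn.Theorems.BalancedSemiprimeLayer.Negative.NatDegreePos

/-!
# `BalancedSemiprimeLayer` (crux stmt-Parity-9469): the crux inequality cannot fail from below

Negative-side boundary lemma (cdisprove, refuter-cdisprove-stmt-Parity-9469-g2-0), PROVED: for every
family `f` of `k` polynomials with positive leading coefficients and degrees `≥ 1` (in particular every
Bateman–Horn system) and every `δ ≥ 0` there is a constant `K = K(f)` with

  `P_f(x) ≤ Φ_f(x, δ) + K + k·(2√x + 1)`   for all `x`

(`polyPrimeCount_le_cruxCount_add`), where `Φ_f(x, δ)` is the crux's left-hand count: an `n ≤ x`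
all of whose values `fᵢ(n)` are prime is counted by `Φ_f` unless `n = 0` or some prime value lies
below its sifting range, `fᵢ(n) < x^{deg fᵢ(1−δ)/2} ≤ x^{deg fᵢ/2}`, which forces `n ≤ 2√x` once
`n` is past a threshold depending on `fᵢ` (`exists_pow_le_two_mul_eval`: `n^{deg f} ≤ 2 f(n)`
eventually). So the crux `Φ_f ≤ P_f + εx/(log x)^k` is an equality up to the balanced-semiprime
LAYER and `O_f(√x)`: it is a statement about that layer only and can fail only from ABOVE (too many
balanced semiprime values). This is also the upper-bound half of the route's Assembly squeeze.
-/

namespace Summit.Parity.BatemanHorn.Theorems.BalancedSemiprimeLayer.Negative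

open Filter Finset Polynomial Real Asymptotics
open scoped Topology
open Literature.NumberTheory.Sieve

/-- Growth: for `P ∈ ℤ[X]` with positive leading coefficient and `d = deg P`, eventually
`n^d ≤ 2·P(n)` along `ℕ`. [folklore] -/
theorem exists_pow_le_two_mul_eval {P : ℤ[X]} (hlc : 0 < P.leadingCoeff) :
    ∃ M : ℕ, ∀ n : ℕ, M ≤ n → (n : ℤ) ^ P.natDegree ≤ 2 * P.eval (n : ℤ) := by
  set Q : ℝ[X] := P.map (Int.castRingHom ℝ) with hQ
  have hinj : Function.Injective (Int.castRingHom ℝ) := Int.cast_injective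
  have hQdeg : Q.natDegree = P.natDegree := natDegree_map_eq_of_injective hinj P
  have hQlc : Q.leadingCoeff = (P.leadingCoeff : ℝ) := by
    rw [hQ, leadingCoeff_map_of_injective hinj, eq_intCast]
  have ha1 : (1 : ℝ) ≤ Q.leadingCoeff := by
    rw [hQlc]
    exact_mod_cast hlc
  obtain ⟨φ, hφ, hEq⟩ := (Polynomial.isEquivalent_atTop_lead Q).exists_eq_mul
  have h1 : ∀ᶠ x : ℝ in atTop, (1 : ℝ) / 2 ≤ φ x :=
    hφ.eventually (eventually_ge_nhds (by norm_num : (1 : ℝ) / 2 < 1))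
  have h2 : ∀ᶠ x : ℝ in atTop, x ^ P.natDegree ≤ 2 * Q.eval x := by
    filter_upwards [h1, hEq, eventually_ge_atTop 0] with x hx1 hx2 hx0
    rw [hx2, Pi.mul_apply, hQdeg]
    have hxd : 0 ≤ x ^ P.natDegree := pow_nonneg hx0 _
    have h3 : (1 : ℝ) / 2 * 1 ≤ φ x * Q.leadingCoeff := mul_le_mul hx1 ha1 (by norm_num) (by linarith)
    have h4 := mul_le_mul_of_nonneg_right h3 hxd
    calc x ^ P.natDegree = 2 * ((1 : ℝ) / 2 * 1 * x ^ P.natDegree) := by ring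
      _ ≤ 2 * (φ x * Q.leadingCoeff * x ^ P.natDegree) := by linarith
      _ = 2 * (φ x * (Q.leadingCoeff * x ^ P.natDegree)) := by ring
  obtain ⟨M, hM⟩ := eventually_atTop.mp (tendsto_natCast_atTop_atTop.eventually h2)
  refine ⟨M, fun n hn => ?_⟩
  have h := hM n hn
  rw [hQ, eval_natCast_map, eq_intCast] at h
  exact_mod_cast h

/-- **The crux inequality cannot fail from below**: `P_f(x) ≤ Φ_f(x, δ) + K + k(2√x + 1)` for a
constant `K = K(f)`, for every family of polynomials with positive leading coefficients and degrees
`≥ 1` and every `δ ≥ 0`. [folklore] -/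
theorem polyPrimeCount_le_cruxCount_add {k : ℕ} (f : Fin k → ℤ[X])
    (hlc : ∀ i, 0 < (f i).leadingCoeff) (hdeg : ∀ i, 0 < (f i).natDegree) {δ : ℝ} (hδ0 : 0 ≤ δ) :
    ∃ K : ℝ, ∀ x : ℕ, (polyPrimeCount f x : ℝ) ≤
      #((Icc 1 x).filter (fun n : ℕ => ∀ i, 0 < (f i).eval (n : ℤ) ∧
        ∀ p ∈ range ⌈(x : ℝ) ^ (((f i).natDegree : ℝ) * (1 - δ) / 2)⌉₊,
          p.Prime → ¬ ((p : ℤ) ∣ (f i).eval (n : ℤ)))) + K + k * (2 * Real.sqrt x + 1) := by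
  choose M hM using fun i => exists_pow_le_two_mul_eval (hlc i)
  refine ⟨1 + ∑ i, (M i : ℝ), fun x => ?_⟩
  -- the sets
  set SP : Finset ℕ := (range (x + 1)).filter (fun n : ℕ =>
    ∀ i, 0 < (f i).eval (n : ℤ) ∧ ((f i).eval (n : ℤ)).toNat.Prime) with hSP
  set T : Finset ℕ := SP.filter (fun n : ℕ => 1 ≤ n ∧
    ∀ i, (x : ℝ) ^ (((f i).natDegree : ℝ) * (1 - δ) / 2) ≤ (((f i).eval (n : ℤ) : ℤ) : ℝ)) with hT
  set B : Fin k → Finset ℕ := fun i => SP.filter (fun n : ℕ =>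
    (((f i).eval (n : ℤ) : ℤ) : ℝ) < (x : ℝ) ^ (((f i).natDegree : ℝ) * (1 - δ) / 2)) with hB
  have hPdef : polyPrimeCount f x = #SP := by
    rw [hSP]
    unfold polyPrimeCount
    congr
  -- (1) `T ⊆` crux filter
  have hTsub : T ⊆ (Icc 1 x).filter (fun n : ℕ => ∀ i, 0 < (f i).eval (n : ℤ) ∧
      ∀ p ∈ range ⌈(x : ℝ) ^ (((f i).natDegree : ℝ) * (1 - δ) / 2)⌉₊,
        p.Prime → ¬ ((p : ℤ) ∣ (f i).eval (n : ℤ))) := by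
    intro n hn
    simp only [hT, hSP, mem_filter, mem_range] at hn
    obtain ⟨⟨hnx, hprime⟩, hn1, hbig⟩ := hn
    simp only [mem_filter, mem_Icc]
    refine ⟨⟨hn1, by omega⟩, fun i => ⟨(hprime i).1, fun p hp hpp hdvd => ?_⟩⟩
    -- `p ∣ fᵢ(n)` prime with `fᵢ(n)` prime ⇒ `p = fᵢ(n) ≥ zᵢ`, contradicting `p < ⌈zᵢ⌉₊`
    have hpos := (hprime i).1
    have hq := (hprime i).2
    set q : ℕ := ((f i).eval (n : ℤ)).toNat with hq_def
    have hqz : (q : ℤ) = (f i).eval (n : ℤ) := Int.toNat_of_nonneg hpos.le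
    have hpq : p ∣ q := by
      rw [← hqz] at hdvd
      exact Int.natCast_dvd_natCast.mp hdvd
    have hpq' : p = q := ((Nat.dvd_prime hq).mp hpq).resolve_left hpp.ne_one
    have hlt : (p : ℝ) < (x : ℝ) ^ (((f i).natDegree : ℝ) * (1 - δ) / 2) :=
      Nat.lt_ceil.mp (mem_range.mp hp)
    have hge := hbig i
    rw [← hqz] at hge
    push_cast at hge
    rw [← hpq'] at hge
    linarith
  -- (2) `SP \ T ⊆ {0} ∪ ⋃ B i`
  have hdiff : SP \ T ⊆ {0} ∪ Finset.univ.biUnion B := by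
    intro n hn
    obtain ⟨hnS, hnT⟩ := Finset.mem_sdiff.mp hn
    rw [mem_union, mem_singleton, mem_biUnion]
    by_cases hn0 : n = 0
    · exact Or.inl hn0
    · right
      have : ¬ (1 ≤ n ∧ ∀ i, (x : ℝ) ^ (((f i).natDegree : ℝ) * (1 - δ) / 2) ≤ (((f i).eval (n : ℤ) : ℤ) : ℝ)) := by
        intro h
        exact hnT (by simp only [hT, mem_filter]; exact ⟨hnS, h⟩)
      push Not at this
      obtain ⟨i, hi⟩ := this (by omega)
      exact ⟨i, mem_univ i, by simp only [hB, mem_filter]; exact ⟨hnS, hi⟩⟩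
  -- (3) `#(B i) ≤ M i + (2√x + 1)`
  have hBcard : ∀ i, (#(B i) : ℝ) ≤ M i + (2 * Real.sqrt x + 1) := by
    intro i
    have hsub : B i ⊆ range (M i) ∪ Iic ⌊2 * Real.sqrt x⌋₊ := by
      intro n hn
      simp only [hB, hSP, mem_filter, mem_range] at hn
      obtain ⟨⟨hnx, -⟩, hsmall⟩ := hn
      rw [mem_union, mem_range, mem_Iic]
      by_cases hMn : n < M i
      · exact Or.inl hMn
      · right
        push Not at hMn
        apply Nat.le_floor
        -- show `(n : ℝ) ≤ 2 √x`
        by_contra hlt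
        push Not at hlt
        have hsx : 0 ≤ Real.sqrt x := Real.sqrt_nonneg _
        have hn1 : 1 ≤ n := by
          by_contra h0
          push Not at h0
          have : n = 0 := by omega
          subst this
          simp at hlt
          linarith
        have hx1 : (1 : ℝ) ≤ x := by exact_mod_cast hn1.trans (by omega : n ≤ x)
        have hx0 : (0 : ℝ) ≤ x := by linarith
        set d := (f i).natDegree with hd
        have hd1 : 1 ≤ d := hdeg i
        -- `n^d ≤ 2 fᵢ(n) < 2 zᵢ ≤ 2 x^{d/2} = 2 (√x)^d ≤ (2√x)^d < n^d`
        have hA : ((n : ℝ)) ^ d ≤ 2 * (((f i).eval (n : ℤ) : ℤ) : ℝ) := by exact_mod_cast hM i n hMn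
        have hz : (x : ℝ) ^ ((d : ℝ) * (1 - δ) / 2) ≤ Real.sqrt x ^ d := by
          rw [Real.sqrt_eq_rpow, ← Real.rpow_natCast, ← Real.rpow_mul hx0]
          refine Real.rpow_le_rpow_of_exponent_le hx1 ?_
          have : (0 : ℝ) ≤ d := Nat.cast_nonneg d
          nlinarith
        have h2d : (2 : ℝ) * Real.sqrt x ^ d ≤ (2 * Real.sqrt x) ^ d := by
          rw [mul_pow]
          refine mul_le_mul_of_nonneg_right ?_ (pow_nonneg hsx d)
          calc (2 : ℝ) = 2 ^ 1 := by norm_num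
            _ ≤ 2 ^ d := pow_le_pow_right₀ (by norm_num) hd1
        have hnd : (2 * Real.sqrt x) ^ d < (n : ℝ) ^ d :=
          pow_lt_pow_left₀ hlt (by positivity) (by omega)
        linarith
    calc (#(B i) : ℝ) ≤ #(range (M i) ∪ Iic ⌊2 * Real.sqrt x⌋₊) := by exact_mod_cast card_le_card hsub
      _ ≤ #(range (M i)) + #(Iic ⌊2 * Real.sqrt x⌋₊) := by exact_mod_cast card_union_le _ _
      _ = M i + (⌊2 * Real.sqrt x⌋₊ + 1 : ℕ) := by rw [card_range, Nat.card_Iic]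
      _ ≤ M i + (2 * Real.sqrt x + 1) := by
          push_cast
          have := Nat.floor_le (show 0 ≤ 2 * Real.sqrt x by positivity)
          linarith
  -- (4) assemble
  have hcardSP : (#SP : ℝ) ≤ #T + (1 + ∑ i, (#(B i) : ℝ)) := by
    have h1 : #SP ≤ #(SP \ T) + #T := card_le_card_sdiff_add_card
    have h2 : #(SP \ T) ≤ #({0} ∪ Finset.univ.biUnion B) := card_le_card hdiff
    have h3 : #({0} ∪ Finset.univ.biUnion B) ≤ 1 + ∑ i, #(B i) :=
      (card_union_le _ _).trans (add_le_add (by simp) card_biUnion_le)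
    have h4 : (#SP : ℝ) ≤ #(SP \ T) + #T := by exact_mod_cast h1
    have h5 : (#(SP \ T) : ℝ) ≤ 1 + ∑ i, (#(B i) : ℝ) := by exact_mod_cast h2.trans h3
    linarith
  have hTcard : (#T : ℝ) ≤ #((Icc 1 x).filter (fun n : ℕ => ∀ i, 0 < (f i).eval (n : ℤ) ∧
      ∀ p ∈ range ⌈(x : ℝ) ^ (((f i).natDegree : ℝ) * (1 - δ) / 2)⌉₊,
        p.Prime → ¬ ((p : ℤ) ∣ (f i).eval (n : ℤ)))) := by exact_mod_cast card_le_card hTsub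
  have hsum : ∑ i, (#(B i) : ℝ) ≤ ∑ i, ((M i : ℝ) + (2 * Real.sqrt x + 1)) :=
    sum_le_sum fun i _ => hBcard i
  rw [sum_add_distrib, sum_const, card_univ, Fintype.card_fin, nsmul_eq_mul] at hsum
  rw [hPdef]
  linarith

end Summit.Parity.BatemanHorn.Theorems.BalancedSemiprimeLayer.Negative
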